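/-
Origin: expansion seat `planner-pub-hodgecm-mc-sanity-1-g10-0`, handover #1 2026-08-20T01:00Z md5 b702823caa28 (SAN-19, bytes UNCHANGED from the g9 DRAFT row of 2026-08-19T22:24Z; REPLACE installed cfc33d34ad0b (M3 ″ body 48a1ca2e3628 + RUN-35 Origin header), 175 → 187 l.; hunk = `Gfin := ⊤` (was `⊥`), `comm_fin _ k _ := by rw [MonoidHom.one_apply]; exact Commute.one_right k`, NEW fields `fin_mem_Gfin _ _ := Subgroup.mem_top _`, `rat_split_level _ _ _ _ := ⟨1, Subgroup.one_mem _, …, fun _ => Commute.one_left _⟩`, rfl lemmas `degThetaAdelicSide_Gfin` / `degS_Gfin … = ⊤`; same 15 declaration names, statements byte-identical except those two rfl lemmas (`⊥` → `⊤`); sole import `Model.ThetaSpaceInputPin`; 0 records / 0 `def … : Prop` / nothing cited / MODEL-N ±0; INSTALL ONLY WITH theta-3-g10 (A)) (`HOME/mc/pub-hodgecm-mc-sanity-1-g9/next38/HodgeCM/Model/Sanity/ThetaAdelicSideDegenerate.lean`, md5 b702823caa28, 187 lines);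
landed by the second packager (p2) in gate run 38 REPLACES the earlier landed copy of `HodgeCM/Model/Sanity/ThetaAdelicSideDegenerate.lean` (verbatim).
-/
/-
RUN-38 rev. (SAN-19) by `planner-pub-hodgecm-mc-sanity-1-g9-0` 2026-08-19 — ADOPTS theta-3-g10's (L3)/(L3b) `Level`-pair courtesy hunk (their draft
ac93c5d32d9c, kit DRAFT faae8cf3c756 row (D)) over the RUN-35/36 installed bytes cfc33d34ad0b: `degThetaAdelicSide` inhabits the two new PIN
FIELDS of `ThetaAdelicSide` (theta-3-g10 row (A) `Model/ThetaSpaceInputPin` 68c7c57560c1): `fin_mem_Gfin := Subgroup.mem_top _`,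
`rat_split_level := ⟨1, …⟩`, with `Gfin := ⊤` (was `⊥`; `comm_fin` now from `ιinf = 1`); rfl/simp lemmas `degThetaAdelicSide_Gfin`,
`degS_Gfin … = ⊤`. Code = theta-3-g10's hunk byte-for-byte; prose (old ll.16/42) corrected `⊥ ↦ ⊤`. INSTALL ONLY
TOGETHER WITH row (A) (atomic unit {(A),(B),(D),period-1 #1101}): under the RUN-37 pin this file does not compile (unknown fields), and
the installed cfc33d34ad0b does not compile under (A) (missing fields).
-/
/-
Origin: SANITY lane `planner-pub-hodgecm-mc-sanity-1-g5-0` (unit pub-hodgecm-mc-sanity-1-g5, gen 5 of mc-sanity-1,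
node SAN-10a), 2026-08-19.  v2 RE-CUT for the coordinated RUN-34 «level-free ιinf + arch × fin splitting» revision of
`HodgeCM.Model.ThetaSpaceInputPin` (mc-theta-3-g3 v2 candidate 5a6bf8038289): SUPERSEDES the RUN-33 bytes 1fb995270957
(gen 4) of this same path — whole-file replacement, same 11 declaration names + 4 new lemmas (`…_Gfin` ×2, `degS_ιinf_apply`, `hRat_degS`);
delta = `ιinf := 1` (level-free), NEW fields `Gfin := ⊤` (RUN-38: was `⊥` until RUN 37), `comm_fin`, `fin_mem_Gfin`, `rat_split` / `rat_split_level` discharged by `1 ∈ G_U(L⁺)` / `1 ∈` every regime, rfl lemmas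
lose their `Γ` argument.  Install ONLY together with theta-3's v2 pin (after it); `HodgeCM.Model.Sanity.ArchKTypeSanity` /
`…PinThetaCollapse` v2 (this seat) import it.  KERNEL: 0 records, 0 hypotheses minted, no global instances, nothing cited.
Expected `#print axioms`: ⊆ {propext, Classical.choice, Quot.sound}.
-/
import Summits.HodgeConjecture.HodgeCM.Model.ThetaSpaceInputPin_2

/-!
# SAN-10a: E's theta-side binder `S` (R9) is a free data binder

Revision R9 of the `E` term (`Model/E2InstanceR9`, mc-glue-1-g4) receives the ADELIC half of the theta-space input as
ONE data binder

  `S : ∀ {L} {ι₁} (V : HermSpace3 L ι₁) (c : SeesawCtx L), Model.ThetaAdelicSide V c`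

(`Model/ThetaSpaceInputPin` § 2: the pair data `P k : WeilPairData L⁺ L (Fin 3) G_U(𝔸)` for `k : Fin 4`, with
`Γ_U := G_U(L⁺)` of the regime model, and the archimedean components `ιinf Γ : U(2,1) →* G_U(𝔸)`), and pins the
GEOMETRIC half (`K₁ = Stab(x₀)`, `τ₁ = weightOf x₀` on `ℂ² = T*_{x₀}𝔹²`, `Δ Γ`, `D Γ`).  Since the RUN-34 revision
(theta-3 v2) `ιinf : U(2,1) →* G_U(𝔸)` is LEVEL-FREE and `S` also carries the arch × fin splitting datum
(`Gfin`, `comm_fin`, `rat_split`), from which E's former binders `hι` (rfl) and `hRat` (`ThetaAdelicSide.hRat`) are KERNEL.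

This file records one kernel fact, citing nothing:

* § 1 **`S` alone is cheap.**  `degThetaAdelicSide V c Φ_∞ x₀ hx₀ : ThetaAdelicSide V c` — trivial Weil action
  `ω := 1`, weight `w := 1`, `ιinf := 1`, `Γ_U := G_U(L⁺)` as the record demands, ANY archimedean test function with
  `Φ_∞(x₀) ≠ 0` ((W-wt), (W-maj⁺), (W-rat⁺) by one-liners, exactly as for SAN-3's `trivialPairData`, whose `Γ_U := ⊤`
  is the only field that had to change), and the splitting datum `Gfin := ⊤` (RUN 38; `⊥` before: `comm_fin` from `ιinf = 1`, `fin_mem_Gfin` trivial, `rat_split` / `rat_split_level` by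
  `ιinf γ · 1 = 1 ∈ G_U(L⁺)`) — so the v2 fields, and with them E-R12's `hRat`, are FREE over a trivial `ιinf` as well;
  with the Mathlib bump `bumpSchwartz` this gives the parameter-free
  `degThetaAdelicSide₀ V c`, the literal binder shape `degS : ∀ {L ι₁} V c, ThetaAdelicSide V c`, and
  `Nonempty (ThetaAdelicSide V c)` over EVERY context.  So `S`, read on its own, constrains nothing.

The junction with mc-theta-3-g3's rigidity theorems (`Model/ArchKTypeRigidity`, `Model/ThetaSpaceInputPinRigidity`: over
the pin `τ₁ = weightOf x₀` has no invariant vector, so any `C : ArchKTypeData … k N`, `N ≠ 0`, forces `(P k).ω ≠ 1`) —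
over `degS` the `K`-type socket `C` of R9 is EMPTY at every positive level, over both branches of the pin, and so is it
over every side whose archimedean component is trivial on `Stab(x₀)` — is SAN-10b (`Sanity/ArchKTypeSanity`).
VERDICT here (MODEL-N += 0): `S` is an unpinned DATA binder, inhabited degenerately over every `(V, c)`; its content is
not in the record but in what `C`/`hol` demand of it.
-/

set_option autoImplicit false

noncomputable section

open NumberField NumberField.mixedEmbedding
open Literature.NumberTheory.Automorphic Literature.NumberTheory.Weil1964
open Literature.AlgebraicGeometry.ShimuraVarieties
open Literature.Geometry.ComplexHyperbolic.BallModel (U21)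
open HodgeCM.PerL34.SupplyAdelic HodgeCM.Model.SupplyInstance HodgeCM.Model.SupplyResidual
open scoped SchwartzMap Classical

namespace HodgeCM
namespace Model
namespace Sanity

/-! ## § 0. A Schwartz bump equal to `1` at a prescribed point (Mathlib's `ContDiffBump`) -/

section Bump

variable {E : Type*} [NormedAddCommGroup E] [NormedSpace ℝ E] [FiniteDimensional ℝ E]

/-- The standard smooth bump around `x` (radii `1 < 2`), complexified, as a Schwartz function. -/
def bumpSchwartz (x : E) : 𝓢(E, ℂ) :=
  let b : ContDiffBump x := ⟨1, 2, one_pos, one_lt_two⟩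
  (b.hasCompactSupport.comp_left (g := fun r : ℝ => (r : ℂ)) Complex.ofReal_zero).toSchwartzMap
    (Complex.ofRealCLM.contDiff.comp b.contDiff)

/-- `bumpSchwartz x x = 1`. -/
@[simp] theorem bumpSchwartz_apply_self (x : E) : bumpSchwartz x x = 1 := by
  let b : ContDiffBump x := ⟨1, 2, one_pos, one_lt_two⟩
  show ((b x : ℝ) : ℂ) = 1
  rw [b.one_of_mem_closedBall (Metric.mem_closedBall_self one_pos.le), Complex.ofReal_one]

end Bump

/-! ## § 1. The degenerate adelic side: trivial Weil action at the prescribed arithmetic subgroup -/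

section PairData

variable (K L : Type) [Field K] [NumberField K] [Field L] [NumberField L] [Algebra K L] [FiniteDimensional K L]
variable (J : Type) [Fintype J] (GU : Type) [Group GU] [TopologicalSpace GU]

/-- **Trivial pair data at a prescribed `Γ_U`**: `ω := 1`, `w := 1`, any `Φ_∞` with `Φ_∞(x₀) ≠ 0`.  (W-wt) is
`one_smul`, (W-maj⁺) holds with the constant majorant `ξ ↦ ‖Φ(ξ)‖` (`summable_norm_ratPt`), (W-rat⁺) because
`1` stabilises `Θ`.  (SAN-3's `SupplyResidual.trivialPairData` is the case `Γ_U := ⊤`.) -/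
@[reducible] def trivialPairDataAt (Γ : Subgroup GU) (Φinf : 𝓢((J → mixedSpace K), ℂ)) (x₀ : J → K)
    (hx₀ : Φinf (archEmb K J x₀) ≠ 0) : WeilPairData K L J GU where
  ΓU := Γ
  ω := 1
  Φinf := Φinf
  x₀ := x₀
  hx₀ := hx₀
  w _ := 1
  weight N t := by rw [MonoidHom.one_apply, Module.End.one_apply, one_smul]
  majorants :=
    ⟨fun Φ ξ => by simpa only [MonoidHom.one_apply, Module.End.one_apply] using continuous_const,
     fun Φ g₀ => ⟨Set.univ, Filter.univ_mem, fun ξ => ‖(Φ : (J → AdeleRing (𝓞 K) K) → ℂ) (ratPt K J ξ)‖,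
       summable_norm_ratPt Φ.2, fun ξ g _ => by rw [MonoidHom.one_apply, Module.End.one_apply]⟩⟩
  theta_rat _ _ _ _ := by rw [MonoidHom.one_apply]; exact Submonoid.one_mem _

end PairData

variable {L : CMField} {ι₁ : L →+* ℂ} (V : HermSpace3 L ι₁) (c : SeesawCtx L)

/-- **The degenerate adelic side** over the regime model `G_U(𝔸) = (V.latticeModel _).G`: all four pair data
trivial at `Γ_U := G_U(L⁺)` (so `hΓU` is `rfl`), archimedean component `ιinf := 1` (level-free), finite factor
`Gfin := ⊤` (so `comm_fin` holds because `ιinf = 1`, `fin_mem_Gfin` is `mem_top`, and `rat_split` / `rat_split_level`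
hold with the corrector `1`: `1 · 1 = 1 ∈ G_U(L⁺)`, `1 ∈` every saturation regime).  (RUN-38 (L3)/(L3b) `Level`-pair
packet: the two new PIN FIELDS of `ThetaAdelicSide` inhabited; `Gfin` flipped `⊥ ↦ ⊤` because `fin_mem_Gfin` asks the
translating elements `e(1, k_f⁻¹)` to lie in `Gfin`.) -/
def degThetaAdelicSide (Φinf : 𝓢((Fin 3 → mixedSpace (maximalRealSubfield L)), ℂ))
    (x₀ : Fin 3 → maximalRealSubfield L) (hx₀ : Φinf (archEmb (maximalRealSubfield L) (Fin 3) x₀) ≠ 0) :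
    ThetaAdelicSide V c where
  P _ := trivialPairDataAt (maximalRealSubfield L) L (Fin 3) (V.latticeModel printFact_unitaryCompact_holds).G
    (V.latticeModel printFact_unitaryCompact_holds).Γ Φinf x₀ hx₀
  hΓU _ := rfl
  ιinf := 1
  Gfin := ⊤
  comm_fin _ k _ := by rw [MonoidHom.one_apply]; exact Commute.one_right k
  rat_split _ _ := ⟨1, Subgroup.one_mem _, by rw [MonoidHom.one_apply, one_mul]; exact Subgroup.one_mem _⟩
  fin_mem_Gfin _ _ := Subgroup.mem_top _
  rat_split_level _ _ _ _ :=
    ⟨1, Subgroup.one_mem _, by rw [MonoidHom.one_apply, one_mul]; exact Subgroup.one_mem _,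
      fun _ => Commute.one_left _⟩

/-- The parameter-free degenerate side: `Φ_∞ :=` the bump at the archimedean image of `x₀ := 0`. -/
def degThetaAdelicSide₀ : ThetaAdelicSide V c :=
  degThetaAdelicSide V c (bumpSchwartz (archEmb (maximalRealSubfield L) (Fin 3) 0)) 0
    (by rw [bumpSchwartz_apply_self]; exact one_ne_zero)

/-- **The literal shape of E's binder `S` (R9), inhabited degenerately.** -/
def degS : ∀ {L : CMField} {ι₁ : L →+* ℂ} (V : HermSpace3 L ι₁) (c : SeesawCtx L), ThetaAdelicSide V c :=
  fun V c => degThetaAdelicSide₀ V c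

/-- `ThetaAdelicSide V c` is inhabited over every context. -/
theorem nonempty_thetaAdelicSide : Nonempty (ThetaAdelicSide V c) := ⟨degS V c⟩

variable {V c}

/-- (Ported verbatim from the HodgeCMPerL package; no docstring in the source.) -/
@[simp] theorem degThetaAdelicSide_P_ω (Φinf : 𝓢((Fin 3 → mixedSpace (maximalRealSubfield L)), ℂ))
    (x₀ : Fin 3 → maximalRealSubfield L) (hx₀ : Φinf (archEmb (maximalRealSubfield L) (Fin 3) x₀) ≠ 0) (k : Fin 4) :
    ((degThetaAdelicSide V c Φinf x₀ hx₀).P k).ω = 1 := rfl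

/-- (Ported verbatim from the HodgeCMPerL package; no docstring in the source.) -/
@[simp] theorem degThetaAdelicSide_ιinf (Φinf : 𝓢((Fin 3 → mixedSpace (maximalRealSubfield L)), ℂ))
    (x₀ : Fin 3 → maximalRealSubfield L) (hx₀ : Φinf (archEmb (maximalRealSubfield L) (Fin 3) x₀) ≠ 0) :
    (degThetaAdelicSide V c Φinf x₀ hx₀).ιinf = 1 := rfl

/-- (Ported verbatim from the HodgeCMPerL package; no docstring in the source.) -/
@[simp] theorem degThetaAdelicSide_Gfin (Φinf : 𝓢((Fin 3 → mixedSpace (maximalRealSubfield L)), ℂ))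
    (x₀ : Fin 3 → maximalRealSubfield L) (hx₀ : Φinf (archEmb (maximalRealSubfield L) (Fin 3) x₀) ≠ 0) :
    (degThetaAdelicSide V c Φinf x₀ hx₀).Gfin = ⊤ := rfl

/-- (Ported verbatim from the HodgeCMPerL package; no docstring in the source.) -/
@[simp] theorem degS_P_ω (k : Fin 4) : ((degS V c).P k).ω = 1 := rfl

/-- (Ported verbatim from the HodgeCMPerL package; no docstring in the source.) -/
@[simp] theorem degS_ιinf : (degS V c).ιinf = 1 := rfl

/-- pointwise form (the shape of SAN-10b's / SAN-11's hypotheses `hι`). -/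
theorem degS_ιinf_apply (u : U21) : (degS V c).ιinf u = 1 := rfl

/-- (Ported verbatim from the HodgeCMPerL package; no docstring in the source.) -/
@[simp] theorem degS_Gfin : (degS V c).Gfin = ⊤ := rfl

/-- E-R12's former binder `hRat` over `degS` (now the kernel lemma `ThetaAdelicSide.hRat` of ANY side): the corrector
is `k := 1`.  Recorded to make the point that the v2 splitting fields certify nothing about `ιinf` on their own. -/
theorem hRat_degS (γ : U21) (hγ : γ ∈ BallRational.ratImage L ι₁ V.Hm V.sylvesterFrame (sylvesterFrame_J V)) :
    ∃ k : (V.latticeModel printFact_unitaryCompact_holds).G,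
      (degS V c).ιinf γ * k ∈ (V.latticeModel printFact_unitaryCompact_holds).Γ ∧
        ∀ x : U21, Commute k ((degS V c).ιinf x) :=
  (degS V c).hRat γ hγ

end Sanity
end Model
end HodgeCM

end
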